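import Mathlib
import Summits.NavierStokesRegularity.NavierStokesRegularity.Theorems.FilamentSkeletonRssAreaLawSlavingKernel
import Summits.NavierStokesRegularity.NavierStokesRegularity.Theorems.FilamentSkeletonRssSkeletonJ1NormalBlockWindow

/-!
# Area-law slaving, part 2 — EXISTENCE of the regular core area through a transversal supercritical slip zero
# (`FilamentSkeletonRss`, child crux `TangentSkeletonNearStraight`, stmt-NavierStokesRegularity-28295, line
# `child_tangent_analytic_strip`, ∃-side of the registered stub `stub_analyticClosing`, step (v) "the transported areas are
# slaved")

THE BRICK.  Let the slip `w ∈ C²(ℝ)` have a unique zero `c`, transversal and supercritical: `w(c) = 0`, `w′(c) > 3/2`,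
`w(τ) = 0 → τ = c`.  Then the AREA LAW of the flat clause block `FlatJ1G` (conjunct
`∀ j, Differentiable ℝ (Aa j) ∧ (∀ τ, 0 < Aa j τ) ∧ ∀ τ, w j τ * deriv (Aa j) τ = (3/2 - deriv (w j) τ) * Aa j τ + 4`)
HAS a solution: there is a differentiable, everywhere positive `A : ℝ → ℝ` with
  `w·A′ = (3/2 − w′)·A + 4` on all of `ℝ`,  `A(c) = 4/(w′(c) − 3/2)`
(`areaLaw_regular_solution_exists`); for an `N`-tuple of slips the areas can be chosen simultaneously, in the letter of the
clause (`areaLaw_family_exists`), and with the slip-slope bound `|w′| ≤ Λ` of the near-straight regime they satisfy the floor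
`Λ⁻¹ ≤ A` of `NearStraightJ1G` for free (`areaLaw_family_exists_with_floor`, via the landed
`Theorems.SkeletonJ1NormalBlockWindow.areaLaw_inv_le_of_deriv_bound`).

PROOF.  Hadamard factorisation `w(c+s) = s·g(s)`, `g(s) = ∫₀¹ w′(c+st) dt ∈ C¹`, `g > 0` (unique transversal zero + IVT);
divide the area law by `g`: `s·Ã′ = a Ã + b` with `a = (3/2 − w′(c+s))/g(s) ∈ C¹`, `b = 4/g ∈ C¹`, `a(0) = −ν`,
`ν = (w′(c) − 3/2)/w′(c) ∈ (0,1)` — a regular singular point with negative exponent, solved by part 1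
(`AreaLawSlaving.singular_regular_solution`); `A(τ) = Ã(τ − c)`.

WHY `C²`.  Differentiability of `A` AT the zero needs the Hadamard quotient `g` (equivalently `w′`) differentiable at `c`;
`w ∈ C²` is the natural sufficient hypothesis (in the skeleton `w_j = ⟪v∘X_j, X_j′⟫` with `v` real-analytic near the ball and
`X_j ∈ C²`, and the construction may take `X_j` smoother).  For `w` merely `C¹` the regular solution exists and is `C¹` off
`c` but can fail to be differentiable at `c`.

HONEST FRAMING: elementary ODE analysis serving a HYPOTHETICAL filament skeleton on the NEGATIVE side of a MODEL route
(A1G aside `TangentSkeletonNearStraight`; the live A1L twin has rigid cores and does not use the area law); nothing here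
bears on Navier–Stokes regularity or blow-up, and no registered stub is closed by this file.
`--supports stmt-NavierStokesRegularity-28295`.
-/

set_option linter.dupNamespace false

noncomputable section

namespace Summit.NavierStokesRegularity.NavierStokesRegularity.Theorems.AreaLawSlaving

open Set MeasureTheory Real
open scoped Topology Interval

/-! ## §1 Hadamard factorisation of the slip at its zero -/

/-- **Hadamard factorisation.**  For `w ∈ C¹` with `w(c) = 0`: `w(c + s) = s · ∫₀¹ w′(c + s t) dt`. [folklore] -/
theorem slip_eq_mul_hadamard {w : ℝ → ℝ} {c : ℝ} (hw : ContDiff ℝ 1 w) (hc : w c = 0) (s : ℝ) :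
    w (c + s) = s * ∫ t in (0:ℝ)..1, deriv w (c + s * t) := by
  have hf : ContDiff ℝ 1 (fun x => w (c + x)) := hw.comp (contDiff_const.add contDiff_id)
  have h := mul_integral_deriv_comp_mul hf s
  have hd : ∀ x, deriv (fun x => w (c + x)) x = deriv w (c + x) := fun x => deriv_comp_const_add w c x
  simp only [hd, add_zero, hc, sub_zero] at h
  exact h.symm

/-- The Hadamard quotient of a `C²` slip is `C¹`. [folklore] -/
theorem contDiff_one_hadamard {w : ℝ → ℝ} {c : ℝ} (hw : ContDiff ℝ 2 w) :
    ContDiff ℝ 1 fun s => ∫ t in (0:ℝ)..1, deriv w (c + s * t) := by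
  have hw' : ContDiff ℝ 1 (deriv w) := by
    have h := (contDiff_succ_iff_deriv (n := 1) (f := w)).mp (by simpa [one_add_one_eq_two] using hw)
    exact h.2.2
  have hψ : ContDiff ℝ 1 (fun x => deriv w (c + x)) := hw'.comp (contDiff_const.add contDiff_id)
  have h1 := contDiff_one_eulerIntegral (ν := 1) one_pos hψ
  have heq : (fun s => ∫ t in (0:ℝ)..1, t ^ ((1:ℝ) - 1) * (fun x => deriv w (c + x)) (s * t)) =
      fun s => ∫ t in (0:ℝ)..1, deriv w (c + s * t) := by
    funext s
    refine intervalIntegral.integral_congr fun t _ => ?_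
    simp only [sub_self, Real.rpow_zero, one_mul]
  rw [heq] at h1
  exact h1

/-- The Hadamard quotient at `0` is the slope `w′(c)`. [folklore] -/
theorem hadamard_zero (w : ℝ → ℝ) (c : ℝ) : ∫ t in (0:ℝ)..1, deriv w (c + 0 * t) = deriv w c := by
  simp

/-- **Sign of the Hadamard quotient.**  If `w ∈ C²` has a UNIQUE zero `c` with `w′(c) > 0`, then the Hadamard quotient
`g(s) = ∫₀¹ w′(c + st) dt` is positive everywhere (it is continuous, equals `w′(c) > 0` at `0`, and vanishes only where
`w(c+s) = s g(s)` vanishes with `s ≠ 0`, i.e. nowhere). [folklore] -/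
theorem hadamard_pos {w : ℝ → ℝ} {c : ℝ} (hw : ContDiff ℝ 2 w) (hc : w c = 0) (hslope : 0 < deriv w c)
    (huniq : ∀ τ, w τ = 0 → τ = c) (s : ℝ) : 0 < ∫ t in (0:ℝ)..1, deriv w (c + s * t) := by
  set g : ℝ → ℝ := fun s => ∫ t in (0:ℝ)..1, deriv w (c + s * t) with hg
  have hgc : Continuous g := (contDiff_one_hadamard (c := c) hw).continuous
  have hg0 : g 0 = deriv w c := hadamard_zero w c
  have hgnz : ∀ s, g s = 0 → s = 0 := by
    intro s hs
    have h1 : w (c + s) = s * g s := slip_eq_mul_hadamard (hw.of_le one_le_two) hc s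
    rw [hs, mul_zero] at h1
    have := huniq _ h1
    linarith
  show 0 < g s
  by_contra hle
  push Not at hle
  -- IVT on `[[0, s]]`: `0 ∈ [[g 0, g s]]` since `g s ≤ 0 < g 0`
  have hmem : (0:ℝ) ∈ [[g 0, g s]] := by
    rw [Set.mem_uIcc]
    exact Or.inr ⟨hle, by rw [hg0]; exact hslope.le⟩
  obtain ⟨x, hx, hx0⟩ := intermediate_value_uIcc hgc.continuousOn hmem
  have hx00 : x = 0 := hgnz x hx0
  rw [hx00, hg0] at hx0
  linarith

/-! ## §2 Existence of the regular core area -/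

/-- **AREA-LAW SLAVING (existence of the regular solution).**  Let `w ∈ C²(ℝ)` with `w(c) = 0`, `w′(c) > 3/2` and
`w(τ) = 0 → τ = c`.  Then there is `A : ℝ → ℝ`, differentiable and positive everywhere, with
`w τ · A′ τ = (3/2 − w′ τ)·A τ + 4` for all `τ` and `A c = 4/(w′(c) − 3/2)`. [Coddington–Levinson 1955, Ch. 4; folklore] -/
theorem areaLaw_regular_solution_exists {w : ℝ → ℝ} {c : ℝ} (hw : ContDiff ℝ 2 w) (hc : w c = 0)
    (hsup : 3 / 2 < deriv w c) (huniq : ∀ τ, w τ = 0 → τ = c) :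
    ∃ A : ℝ → ℝ, Differentiable ℝ A ∧ (∀ τ, 0 < A τ) ∧
      (∀ τ, w τ * deriv A τ = (3 / 2 - deriv w τ) * A τ + 4) ∧ A c = 4 / (deriv w c - 3 / 2) := by
  have hw1 : ContDiff ℝ 1 w := hw.of_le one_le_two
  have hw' : ContDiff ℝ 1 (deriv w) := by
    have h := (contDiff_succ_iff_deriv (n := 1) (f := w)).mp (by simpa [one_add_one_eq_two] using hw)
    exact h.2.2
  -- Hadamard quotient
  obtain ⟨g, hg⟩ : ∃ g : ℝ → ℝ, g = fun s => ∫ t in (0:ℝ)..1, deriv w (c + s * t) := ⟨_, rfl⟩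
  have hgC1 : ContDiff ℝ 1 g := by rw [hg]; exact contDiff_one_hadamard hw
  have hg0 : g 0 = deriv w c := by rw [hg]; exact hadamard_zero w c
  have hgpos : ∀ s, 0 < g s := fun s => by
    rw [hg]; exact hadamard_pos hw hc (by linarith) huniq s
  have hgne : ∀ s, g s ≠ 0 := fun s => (hgpos s).ne'
  have hwg : ∀ s, w (c + s) = s * g s := fun s => by rw [hg]; exact slip_eq_mul_hadamard hw1 hc s
  -- the coefficients of the reduced singular equation
  set lam : ℝ := deriv w c with hlam
  have hlam0 : 0 < lam := by linarith
  set ν : ℝ := (lam - 3 / 2) / lam with hν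
  have hνpos : 0 < ν := div_pos (by linarith) hlam0
  obtain ⟨a, ha⟩ : ∃ a : ℝ → ℝ, a = fun s => (3 / 2 - deriv w (c + s)) / g s := ⟨_, rfl⟩
  obtain ⟨b, hb⟩ : ∃ b : ℝ → ℝ, b = fun s => 4 / g s := ⟨_, rfl⟩
  have haC1 : ContDiff ℝ 1 a := by
    rw [ha]
    exact (contDiff_const.sub (hw'.comp (contDiff_const.add contDiff_id))).div hgC1 hgne
  have hbC1 : ContDiff ℝ 1 b := by rw [hb]; exact contDiff_const.div hgC1 hgne
  have ha0 : a 0 = -ν := by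
    rw [ha, hν]; simp only [add_zero]; rw [hg0]
    field_simp
    ring
  have hbpos : ∀ s, 0 < b s := fun s => by rw [hb]; exact div_pos (by norm_num) (hgpos s)
  -- part 1
  obtain ⟨At, hAd, hApos, hAode, hA0⟩ := singular_regular_solution hνpos haC1 hbC1 ha0 hbpos
  refine ⟨fun τ => At (τ - c), fun τ => (hAd (τ - c)).comp τ ((differentiableAt_id).sub_const c),
    fun τ => hApos _, fun τ => ?_, ?_⟩
  · -- the area law at `τ`, from the reduced equation at `s = τ - c`
    have hder : deriv (fun τ => At (τ - c)) τ = deriv At (τ - c) := deriv_comp_sub_const At c τ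
    rw [hder]
    have hode := hAode (τ - c)
    have hwτ : w τ = (τ - c) * g (τ - c) := by
      have := hwg (τ - c); rwa [add_sub_cancel] at this
    have haτ : a (τ - c) = (3 / 2 - deriv w τ) / g (τ - c) := by
      rw [ha]; simp only [add_sub_cancel]
    have hbτ : b (τ - c) = 4 / g (τ - c) := by rw [hb]
    rw [haτ, hbτ] at hode
    have hgτ := hgne (τ - c)
    -- multiply the reduced equation by `g`
    have h2 : (τ - c) * g (τ - c) * deriv At (τ - c) =
        g (τ - c) * ((3 / 2 - deriv w τ) / g (τ - c) * At (τ - c) + 4 / g (τ - c)) := by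
      rw [← hode]; ring
    rw [hwτ, h2]
    field_simp
  · -- value at the zero
    simp only [sub_self]
    rw [hA0, hb]
    simp only
    rw [hg0, hν]
    field_simp

/-- **The area-law conjunct of `FlatJ1G`, inhabited.**  For an `N`-tuple of `C²` slips with transversal supercritical
unique zeros there are core areas in the LETTER of the clause
`∀ j, Differentiable ℝ (Aa j) ∧ (∀ τ, 0 < Aa j τ) ∧ ∀ τ, w j τ * deriv (Aa j) τ = (3/2 - deriv (w j) τ) * Aa j τ + 4`,
with `Aa j (c j) = 4/(w_j′(c_j) − 3/2)`. [folklore] -/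
theorem areaLaw_family_exists {N : ℕ} {w : Fin N → ℝ → ℝ} {c : Fin N → ℝ} (hw : ∀ j, ContDiff ℝ 2 (w j))
    (hc : ∀ j, w j (c j) = 0) (hsup : ∀ j, 3 / 2 < deriv (w j) (c j)) (huniq : ∀ j τ, w j τ = 0 → τ = c j) :
    ∃ Aa : Fin N → ℝ → ℝ, (∀ j, Differentiable ℝ (Aa j) ∧ (∀ τ, 0 < Aa j τ) ∧
      ∀ τ, w j τ * deriv (Aa j) τ = (3 / 2 - deriv (w j) τ) * Aa j τ + 4) ∧
      ∀ j, Aa j (c j) = 4 / (deriv (w j) (c j) - 3 / 2) := by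
  have h : ∀ j, ∃ A : ℝ → ℝ, Differentiable ℝ A ∧ (∀ τ, 0 < A τ) ∧
      (∀ τ, w j τ * deriv A τ = (3 / 2 - deriv (w j) τ) * A τ + 4) ∧ A (c j) = 4 / (deriv (w j) (c j) - 3 / 2) :=
    fun j => areaLaw_regular_solution_exists (hw j) (hc j) (hsup j) (huniq j)
  choose Aa hAa using h
  exact ⟨Aa, fun j => ⟨(hAa j).1, (hAa j).2.1, (hAa j).2.2.1⟩, fun j => (hAa j).2.2.2⟩

/-- **With the floor of the near-straight regime.**  If moreover `|w_j′| ≤ Λ` (the slip-slope conjunct of `NearStraightJ1G`),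
the slaved areas satisfy the core-area floor `Λ⁻¹ ≤ Aa j τ` of `NearStraightJ1G` for free
(Theorems.SkeletonJ1NormalBlockWindow.areaLaw_inv_le_of_deriv_bound). [folklore] -/
theorem areaLaw_family_exists_with_floor {N : ℕ} {w : Fin N → ℝ → ℝ} {c : Fin N → ℝ} {Λ : ℝ}
    (hw : ∀ j, ContDiff ℝ 2 (w j)) (hc : ∀ j, w j (c j) = 0) (hsup : ∀ j, 3 / 2 < deriv (w j) (c j))
    (huniq : ∀ j τ, w j τ = 0 → τ = c j) (hΛ : ∀ j τ, |deriv (w j) τ| ≤ Λ) :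
    ∃ Aa : Fin N → ℝ → ℝ, (∀ j, Differentiable ℝ (Aa j) ∧ (∀ τ, 0 < Aa j τ) ∧
      ∀ τ, w j τ * deriv (Aa j) τ = (3 / 2 - deriv (w j) τ) * Aa j τ + 4) ∧
      (∀ j, Aa j (c j) = 4 / (deriv (w j) (c j) - 3 / 2)) ∧ (∀ j τ, Λ⁻¹ ≤ Aa j τ) := by
  obtain ⟨Aa, hAa, hAc⟩ := areaLaw_family_exists hw hc hsup huniq
  refine ⟨Aa, hAa, hAc, fun j τ => ?_⟩
  exact Summit.NavierStokesRegularity.NavierStokesRegularity.Theorems.SkeletonJ1NormalBlockWindow.areaLaw_inv_le_of_deriv_bound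
    ((hw j).differentiable two_ne_zero) (hAa j).1 (hAa j).2.2 (hAa j).2.1 (hc j) (hΛ j) τ

end Summit.NavierStokesRegularity.NavierStokesRegularity.Theorems.AreaLawSlaving

end
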